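import Mathlib
import Summits.MatrixMultiplication.MatrixMultiplication.Theses.LevelGradedCohnUmans
import Summits.MatrixMultiplication.MatrixMultiplication.Theorems.LieRankDesigns.Negative.Basics

/-!
# Stub `stub_card_targets` — line `Sketch` of the crux `LevelOneGL2Designs`
(stmt-MatrixMultiplication-14080)

Under the quadruple-form triple product property

  `∀ x₀ z₀ x y y' z, x⁻¹ y y'⁻¹ z = x₀⁻¹ z₀ → x = x₀ ∧ y = y' ∧ z = z₀`

with `Y` non-empty, the target map `(x, z) ↦ x⁻¹ z` is injective on `X ×ˢ Z` (take `y = y'`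
in the hypothesis), hence the set of targets has exactly `|X| · |Z|` elements
(`Finset.card_image_of_injOn` and `Finset.card_product`).
-/

set_option linter.dupNamespace false

noncomputable section

open scoped BigOperators

namespace Summit.MatrixMultiplication.MatrixMultiplication.Theorems.LevelOneGL2Designs.FlagLine

open Summit.MatrixMultiplication.MatrixMultiplication.Theses.LevelGradedCohnUmans
open Summit.MatrixMultiplication.MatrixMultiplication.Theorems.LieRankDesigns.Negative

section Sandwich

variable {G : Type} [Group G] [DecidableEq G]

/-- **Targets are distinct under TPP.**  If the quadruple-form TPP holds and `Y ≠ ∅`, the map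
`(x, z) ↦ x⁻¹ z` is injective on `X × Z`, so there are exactly `|X|·|Z|` targets. [elementary] -/
theorem stub_card_targets (X Y Z : Finset G) (hY : Y.Nonempty)
    (hT : ∀ x₀ ∈ X, ∀ z₀ ∈ Z, ∀ x ∈ X, ∀ y ∈ Y, ∀ y' ∈ Y, ∀ z ∈ Z,
        x⁻¹ * y * y'⁻¹ * z = x₀⁻¹ * z₀ → x = x₀ ∧ y = y' ∧ z = z₀) :
    ((X ×ˢ Z).image fun q => q.1⁻¹ * q.2).card = X.card * Z.card := by
  obtain ⟨y, hy⟩ := hY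
  rw [Finset.card_image_of_injOn, Finset.card_product]
  rintro ⟨x, z⟩ hxz ⟨x₀, z₀⟩ hxz₀ h
  rw [Finset.mem_coe, Finset.mem_product] at hxz hxz₀
  have key : x⁻¹ * y * y⁻¹ * z = x₀⁻¹ * z₀ := by
    rw [mul_assoc x⁻¹, mul_inv_cancel, mul_one]
    exact h
  obtain ⟨hx, -, hz⟩ := hT x₀ hxz₀.1 z₀ hxz₀.2 x hxz.1 y hy y hy z hxz.2 key
  exact Prod.ext hx hz

end Sandwich

end Summit.MatrixMultiplication.MatrixMultiplication.Theorems.LevelOneGL2Designs.FlagLine
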